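import Mathlib
import Summits.Ventures.Crystal3D.Theses.StickyWulffConstant
import Summits.Ventures.Crystal3D.Theorems.StickyWulffConstantTextureLiminfTexShadowDefs
import Summits.Ventures.Crystal3D.Theorems.StickyWulffConstantTextureLiminfTexShadowVocabulary
import HarnessLib

/-!
# Line `TexShadow` at LAW v5 `(c₀, c₁) = (13/25, ½)` — TEXTURE VOCABULARY, parametric in the law (T-V5 PORT, file P1)
# (lane T; new crux `TextureLiminfV5`, stmt-Ventures-23912; cf-p1 g30 memo HOME/cf-p1/T-V5-PORT.md, 2026-08-29T00:50:56Z)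

HONEST FRAMING. Venture `Summits/Ventures/Crystal3D` (cell `crystal3d-full`), route `route-Ventures-StickyWulffConstant`.
Split v5 (route rev 11, 2026-08-29) added the law-v5 crux `TextureLiminfV5` (stmt-Ventures-23912): the v4 text with the
hypothesis `GenericWallFloorV5` (`c₀ = 13/25`) in place of `GenericWallFloor` (`c₀ = 1`) and the texture clause
`¬CoAx ⇒ m = 0 ∧ 13/25 ≤ c`.  The tree's texture vocabulary (`…TexShadowVocabulary`, v6.2) bakes the law `(1, ½)` into the two
closed statements `ShadowTheorem` / `ShadowTheoremSat`.  This file is P1 of the port ORDER: the SAME two statements and the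
structured form of the route item, PARAMETRIC in the law `(c₀, c₁)` and in the two wall siblings `(GWF, CWL)` («better
engineering» option of the memo — a later move of the law constant costs nothing), plus the v5 names as instances and four
`Iff.rfl` certificates (the v4 closed statements ARE the instances at `(1, ½, GenericWallFloor, CoaxialWallLaw)`; the route items
`TextureLiminf` / `TextureLiminfV5` ARE the structured forms).  `IsTexture c₀ c₁`, `energy`, `vol`, `IsSaturated` are the tree's
(already parametric); nothing of v4 is touched.  DEFINITIONS ONLY (+ `Iff.rfl`); nothing is proved or claimed about the stubs.

* `ShadowTheoremAt c₀ c₁ GWF CWL`, `ShadowTheoremSatAt c₀ c₁ GWF CWL` — single-configuration shadow theorems at law `(c₀, c₁)`;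
* `TexLiminfAt c₀ c₁ GWF CWL` — the structured (profile) form of the route items at law `(c₀, c₁)`;
* `ShadowTheoremV5`, `ShadowTheoremSatV5`, `TexLiminfV5` — the instances at `(13/25, ½, GenericWallFloorV5, CoaxialWallLaw)`;
* `shadowTheorem_iff_at`, `shadowTheoremSat_iff_at`, `textureLiminf_iff_at`, `textureLiminfV5_iff` — `Iff.rfl` certificates.
P2 (`…UnsaturateV5`: `shadowTheoremAt_of_sat` for every law) and the Bolzano–Weierstrass composition
(`…TexShadowCompositionV5`: `ShadowTheoremAt ⇒ TexLiminfAt`, hence `ShadowTheoremSatV5 → TextureLiminfV5`) are separate proof files.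
WHAT THIS IS NOT: any statement about the wall laws or the texture build; rung F-C1 not moved.
-/

open scoped BigOperators InnerProductSpace ENNReal Pointwise
open MeasureTheory Filter Finset

namespace Summit.Ventures.Crystal3D.Cruxes.TextureLiminf.TexShadow

open Summit.Ventures.Crystal3D

/-! ## §1 The shadow theorems at a general law `(c₀, c₁)` with wall siblings `(GWF, CWL)` -/

/-- **The shadow theorem at law `(c₀, c₁)`** (single configuration, finite `N`), with the two wall-law siblings `GWF`
(generic wall floor) and `CWL` (co-axial wall law) as parameters: `…TexShadowVocabulary.ShadowTheorem` is the instance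
`(1, ½, GenericWallFloor, CoaxialWallLaw)` (`shadowTheorem_iff_at`), `ShadowTheoremV5` the instance
`(13/25, ½, GenericWallFloorV5, CoaxialWallLaw)`. -/
def ShadowTheoremAt (c₀ c₁ : ℝ) (GWF CWL : Prop) : Prop :=
  GWF → CWL →
  Summit.Ventures.Crystal3D.Theses.StickyWulffConstant.NoReconstructionGain →
  Summit.Ventures.Crystal3D.Theses.StickyWulffConstant.StackingLiminf →
  ∀ K δ θ : ℝ, 0 < δ → 0 < θ → ∃ N₀ : ℕ, ∀ N : ℕ, N₀ ≤ N → ∀ x : Fin N → E3, IsUnitPacking x →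
    6 * (N : ℝ) - (numContacts x : ℝ) ≤ K * (N : ℝ) ^ ((2 : ℝ) / 3) →
    ∃ (n : ℕ) (G : Fin n → Set E3) (A : Fin n → (E3 ≃ₗᵢ[ℝ] E3)) (c : Fin n → Fin n → ℝ)
      (m : Fin n → Fin n → E3), IsTexture c₀ c₁ n G A c m ∧ 1 - δ ≤ Real.sqrt 2 * vol n G ∧
      energy n G A c m ≤ (6 * (N : ℝ) - (numContacts x : ℝ)) / (N : ℝ) ^ ((2 : ℝ) / 3) + θ

/-- **The shadow theorem for 6|6-saturated clusters at law `(c₀, c₁)`** (`IsSaturated x` added to the hypotheses of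
`ShadowTheoremAt`); `ShadowTheoremSat` is the instance `(1, ½, GenericWallFloor, CoaxialWallLaw)`. -/
def ShadowTheoremSatAt (c₀ c₁ : ℝ) (GWF CWL : Prop) : Prop :=
  GWF → CWL →
  Summit.Ventures.Crystal3D.Theses.StickyWulffConstant.NoReconstructionGain →
  Summit.Ventures.Crystal3D.Theses.StickyWulffConstant.StackingLiminf →
  ∀ K δ θ : ℝ, 0 < δ → 0 < θ → ∃ N₀ : ℕ, ∀ N : ℕ, N₀ ≤ N → ∀ x : Fin N → E3, IsUnitPacking x →
    IsSaturated x →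
    6 * (N : ℝ) - (numContacts x : ℝ) ≤ K * (N : ℝ) ^ ((2 : ℝ) / 3) →
    ∃ (n : ℕ) (G : Fin n → Set E3) (A : Fin n → (E3 ≃ₗᵢ[ℝ] E3)) (c : Fin n → Fin n → ℝ)
      (m : Fin n → Fin n → E3), IsTexture c₀ c₁ n G A c m ∧ 1 - δ ≤ Real.sqrt 2 * vol n G ∧
      energy n G A c m ≤ (6 * (N : ℝ) - (numContacts x : ℝ)) / (N : ℝ) ^ ((2 : ℝ) / 3) + θ

/-- **Structured (profile) form of the route items `TextureLiminf` / `TextureLiminfV5` at law `(c₀, c₁)`** with wall siblings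
`(GWF, CWL)`: along every near-optimal sequence of unit packings a subsequence is shadowed by finitely many finite
`(c₀, c₁)`-textures of total mass `≥ 1 − δ` and total energy eventually `≤ deficiency/N^{2/3} + η` (the skeleton's
`TexLiminf GWF CWL` is the instance `c₀ = 1, c₁ = ½`). -/
def TexLiminfAt (c₀ c₁ : ℝ) (GWF CWL : Prop) : Prop :=
  GWF → CWL → Summit.Ventures.Crystal3D.Theses.StickyWulffConstant.NoReconstructionGain →
  Summit.Ventures.Crystal3D.Theses.StickyWulffConstant.StackingLiminf →
  ∀ K δ η : ℝ, 0 < δ → 0 < η →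
  ∀ (Nseq : ℕ → ℕ) (x : (k : ℕ) → Fin (Nseq k) → E3),
    (∀ k, IsUnitPacking (x k)) → Tendsto Nseq atTop atTop →
    (∀ k, 6 * (Nseq k : ℝ) - (numContacts (x k) : ℝ) ≤ K * (Nseq k : ℝ) ^ ((2 : ℝ) / 3)) →
    ∃ φ : ℕ → ℕ, StrictMono φ ∧
    ∃ (p : ℕ) (n : Fin p → ℕ) (G : (i : Fin p) → Fin (n i) → Set E3)
      (A : (i : Fin p) → Fin (n i) → (E3 ≃ₗᵢ[ℝ] E3)) (c : (i : Fin p) → Fin (n i) → Fin (n i) → ℝ)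
      (m : (i : Fin p) → Fin (n i) → Fin (n i) → E3),
      (∀ i, IsTexture c₀ c₁ (n i) (G i) (A i) (c i) (m i)) ∧
      1 - δ ≤ Real.sqrt 2 * ∑ i, vol (n i) (G i) ∧
      ∀ᶠ k in atTop, (∑ i, energy (n i) (G i) (A i) (c i) (m i)) - η ≤
        (6 * (Nseq (φ k) : ℝ) - (numContacts (x (φ k)) : ℝ)) / (Nseq (φ k) : ℝ) ^ ((2 : ℝ) / 3)

/-! ## §2 The law-v5 instances `(13/25, ½)` with wall siblings `(GenericWallFloorV5, CoaxialWallLaw)` -/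

/-- **The shadow theorem at law v5** `(13/25, ½)`, wall siblings `GenericWallFloorV5` (stmt-Ventures-23910) and `CoaxialWallLaw`
(stmt-Ventures-19481). -/
def ShadowTheoremV5 : Prop :=
  ShadowTheoremAt (13 / 25) (1 / 2) Summit.Ventures.Crystal3D.Theses.StickyWulffConstant.GenericWallFloorV5
    Summit.Ventures.Crystal3D.Theses.StickyWulffConstant.CoaxialWallLaw

/-- **The saturated shadow theorem at law v5** `(13/25, ½)` — the target of `stub_textureBuild` in TexShadow v7. -/
def ShadowTheoremSatV5 : Prop :=
  ShadowTheoremSatAt (13 / 25) (1 / 2) Summit.Ventures.Crystal3D.Theses.StickyWulffConstant.GenericWallFloorV5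
    Summit.Ventures.Crystal3D.Theses.StickyWulffConstant.CoaxialWallLaw

/-- **Structured form of the route item `TextureLiminfV5`** (stmt-Ventures-23912). -/
def TexLiminfV5 : Prop :=
  TexLiminfAt (13 / 25) (1 / 2) Summit.Ventures.Crystal3D.Theses.StickyWulffConstant.GenericWallFloorV5
    Summit.Ventures.Crystal3D.Theses.StickyWulffConstant.CoaxialWallLaw

/-! ## §3 `Iff.rfl` certificates -/

/-- The v4 closed statement `ShadowTheorem` IS the instance `(1, ½, GenericWallFloor, CoaxialWallLaw)` of `ShadowTheoremAt`. -/
theorem shadowTheorem_iff_at :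
    ShadowTheorem ↔ ShadowTheoremAt 1 (1 / 2) Summit.Ventures.Crystal3D.Theses.StickyWulffConstant.GenericWallFloor
      Summit.Ventures.Crystal3D.Theses.StickyWulffConstant.CoaxialWallLaw :=
  Iff.rfl

/-- The v4 closed statement `ShadowTheoremSat` IS the instance `(1, ½, GenericWallFloor, CoaxialWallLaw)` of `ShadowTheoremSatAt`. -/
theorem shadowTheoremSat_iff_at :
    ShadowTheoremSat ↔ ShadowTheoremSatAt 1 (1 / 2) Summit.Ventures.Crystal3D.Theses.StickyWulffConstant.GenericWallFloor
      Summit.Ventures.Crystal3D.Theses.StickyWulffConstant.CoaxialWallLaw :=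
  Iff.rfl

/-- The ROUTE item `TextureLiminf` (stmt-Ventures-19483, law `(1, ½)`) IS the structured `TexLiminfAt 1 (1/2) G F`. -/
theorem textureLiminf_iff_at :
    Summit.Ventures.Crystal3D.Theses.StickyWulffConstant.TextureLiminf ↔
      TexLiminfAt 1 (1 / 2) Summit.Ventures.Crystal3D.Theses.StickyWulffConstant.GenericWallFloor
        Summit.Ventures.Crystal3D.Theses.StickyWulffConstant.CoaxialWallLaw :=
  Iff.rfl

/-- The ROUTE item `TextureLiminfV5` (stmt-Ventures-23912, law `(13/25, ½)`) IS the structured `TexLiminfV5`. -/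
theorem textureLiminfV5_iff :
    Summit.Ventures.Crystal3D.Theses.StickyWulffConstant.TextureLiminfV5 ↔ TexLiminfV5 :=
  Iff.rfl

end Summit.Ventures.Crystal3D.Cruxes.TextureLiminf.TexShadow
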